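import Summits.QuantumFields.YangMills.Theses.LogConcaveChart

/-!
# `LogConcaveChart.SkewAtChartUnit` (stmt-QuantumFields-26932): its chart-package hypothesis is vacuous

Refuter finding (negative lane, supports stmt-QuantumFields-26932; nothing here asserts a Theses decl).
The hypothesis of `SkewAtChartUnit` — "the unit `(r, a)` carries a log-concave chart package for SOME
`K > 0`, `0 < δ ≤ 1`, positive-time mode `v`, scale `ε > 0`" — is inhabited at EVERY `(G, r, a, β, L)` by a
junk package that never looks at the Wilson measure: `v = 0` (so `Af = Ag = 0`), the constant chart `Φ ≡ 0`
into `ℝ²`, the standard Gaussian model `A x = (x₀² + x₁²)/2`, `H₀ = !![1, -1/4; -1/4, 1]` (`δ = 1/2`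
sandwich), `f = x₀ x₁`, `g = x₀² + x₁²` (model covariance `0` by the reflection `x₀ ↦ -x₀`, while the
Gaussian proxy `rC = 256/225 > 0`), `ε = 32/225`, `K = 40`.  Hence `SkewAtChartUnit` is EQUIVALENT to
NT clause (ii) (three-point skewness floor) at EVERY unit `a → 0` of EVERY faithful representation — the
"pinning to the chart unit" is void (`skewAtChartUnit_iff_forall_units`).  Repair (planner): make the
hypothesis load-bearing, e.g. the `∃ K, ∀ δ` package of `UnitScaleChart` at this unit, or add the derived
two-point floor `ε ≤ Q2 G r β L (a β) (ϑv) v` (clause (i) of `LowerBounds`) to the hypothesis.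
-/

set_option autoImplicit false

noncomputable section

open scoped SchwartzMap Matrix
open MeasureTheory Filter Topology
open Literature.MathematicalPhysics.QuantumFieldTheory Literature.MathematicalPhysics.QuantumLattice
  Literature.Probability.LatticeModels
  Summit.QuantumFields.YangMills.Cruxes.OSLegsFromFemtoAndGap.DlrCollarTransfer

namespace Summit.QuantumFields.YangMills.Theorems.LogConcaveChartSkewAtChartUnit.Negative

-- The junk witnesses are fixed numerals / closed terms; they are introduced as LOCAL NOTATION (no new
-- definitions enter the tree).
/-- the junk reference Hessian `H₀` (breaks the `x₀ ↔ x₁` symmetry so that `rC ≠ 0`) -/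
local notation "H0m" => (!![1, -1/4; -1/4, 1] : Matrix (Fin 2) (Fin 2) ℝ)
/-- its inverse -/
local notation "H0i" => (!![16/15, 4/15; 4/15, 16/15] : Matrix (Fin 2) (Fin 2) ℝ)
/-- the quadratic form of `f = x₀ x₁` -/
local notation "Hfm" => (!![0, 1/2; 1/2, 0] : Matrix (Fin 2) (Fin 2) ℝ)
/-- the junk model potential: standard Gaussian on `ℝ²` -/
local notation "Afun" => (fun x : Fin 2 → ℝ => (x 0 ^ 2 + x 1 ^ 2) / 2)
/-- the reflection `x₀ ↦ -x₀` -/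
local notation "flip0" =>
  (fun (x : Fin 2 → ℝ) (i : Fin 2) => (![Neg.neg, id] : Fin 2 → ℝ → ℝ) i (x i))

/-- `H0i` is a right inverse of `H0m`. -/
theorem H0m_mul_H0i : H0m * H0i = 1 := by
  ext i j; fin_cases i <;> fin_cases j <;> simp [Matrix.mul_apply, Fin.sum_univ_two] <;> norm_num

/-- hence `H0m⁻¹ = H0i`. -/
theorem H0m_inv : H0m⁻¹ = H0i := Matrix.inv_eq_right_inv H0m_mul_H0i

/-- the reflection `x₀ ↦ -x₀` preserves Lebesgue measure on `ℝ²`. -/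
theorem flip0_measurePreserving : MeasurePreserving flip0 volume volume := by
  refine MeasureTheory.volume_preserving_pi (α' := fun _ : Fin 2 => ℝ) (β' := fun _ : Fin 2 => ℝ)
    (f := (![Neg.neg, id] : Fin 2 → ℝ → ℝ)) (fun i => ?_)
  fin_cases i
  · simpa using Measure.measurePreserving_neg (volume : Measure ℝ)
  · simpa using MeasurePreserving.id (volume : Measure ℝ)

/-- a continuous function odd under `flip0` has integral `0` (junk-safe: no integrability needed). -/
theorem integral_eq_zero_of_flip0_odd {F : (Fin 2 → ℝ) → ℝ} (hF : Continuous F)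
    (hodd : ∀ x, F (flip0 x) = -F x) : ∫ x, F x = 0 := by
  have h1 : ∫ x, F x = ∫ x, F (flip0 x) := by
    calc ∫ x, F x = ∫ x, F x ∂(Measure.map flip0 volume) := by rw [flip0_measurePreserving.map_eq]
      _ = ∫ x, F (flip0 x) := integral_map flip0_measurePreserving.measurable.aemeasurable
            hF.aestronglyMeasurable
  have h2 : ∫ x, F (flip0 x) = -∫ x, F x := by
    simp_rw [hodd, integral_neg]
  linarith

/-- the model potential is even under `flip0`. -/
theorem Afun_flip0 (x : Fin 2 → ℝ) : Afun (flip0 x) = Afun x := by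
  simp

/-- the model potential is continuous. -/
theorem continuous_Afun : Continuous Afun := by
  fun_prop

/-- the quadratic form of `Hfm` is `x₀ x₁`. -/
theorem f_eq (x : Fin 2 → ℝ) : x ⬝ᵥ Hfm *ᵥ x = x 0 * x 1 := by
  simp [Matrix.mulVec, dotProduct, Fin.sum_univ_two]; ring

/-- centring of the junk model -/
theorem centred (i : Fin 2) : ∫ x : Fin 2 → ℝ, x i * Real.exp (-Afun x) = 0 := by
  fin_cases i
  · refine integral_eq_zero_of_flip0_odd (by have := continuous_Afun; fun_prop) (fun x => ?_)
    rw [Afun_flip0]; simp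
  · -- use the reflection of the other coordinate via symmetry of the statement: swap roles
    have h := MeasureTheory.volume_preserving_pi (α' := fun _ : Fin 2 => ℝ) (β' := fun _ : Fin 2 => ℝ)
      (f := fun i : Fin 2 => if i = 1 then (fun t : ℝ => -t) else id) (fun i => by
        by_cases hi : i = 1
        · simp only [hi, if_true]; exact Measure.measurePreserving_neg volume
        · simp only [hi, if_false]; exact MeasurePreserving.id volume)
    set T : (Fin 2 → ℝ) → (Fin 2 → ℝ) := fun x i => (if i = 1 then (fun t : ℝ => -t) else id) (x i) with hT
    have hF : Continuous fun x : Fin 2 → ℝ => x 1 * Real.exp (-Afun x) := by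
      have := continuous_Afun; fun_prop
    have h1 : ∫ x : Fin 2 → ℝ, x 1 * Real.exp (-Afun x) = ∫ x, (T x) 1 * Real.exp (-Afun (T x)) := by
      calc ∫ x : Fin 2 → ℝ, x 1 * Real.exp (-Afun x)
          = ∫ x, x 1 * Real.exp (-Afun x) ∂(Measure.map T volume) := by rw [h.map_eq]
        _ = ∫ x, (T x) 1 * Real.exp (-Afun (T x)) := integral_map h.measurable.aemeasurable
              hF.aestronglyMeasurable
    have h2 : ∫ x, (T x) 1 * Real.exp (-Afun (T x)) = -∫ x : Fin 2 → ℝ, x 1 * Real.exp (-Afun x) := by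
      rw [← integral_neg]; congr 1; funext x; simp [hT]
    simp only [Fin.mk_one] 
    linarith

/-- the model covariance numerator vanishes: `∫ f g e^{-A} = 0` -/
theorem int_fg :
    ∫ x : Fin 2 → ℝ, x ⬝ᵥ Hfm *ᵥ x * (x ⬝ᵥ x) * Real.exp (-((x 0 ^ 2 + x 1 ^ 2) / 2)) = 0 := by
  refine integral_eq_zero_of_flip0_odd (by unfold dotProduct Matrix.mulVec; fun_prop) (fun x => ?_)
  rw [f_eq, f_eq]
  simp [dotProduct, Fin.sum_univ_two]

/-- `∫ f e^{-A} = 0`. -/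
theorem int_f : ∫ x : Fin 2 → ℝ, x ⬝ᵥ Hfm *ᵥ x * Real.exp (-((x 0 ^ 2 + x 1 ^ 2) / 2)) = 0 := by
  refine integral_eq_zero_of_flip0_odd (by unfold dotProduct Matrix.mulVec; fun_prop) (fun x => ?_)
  rw [f_eq, f_eq]
  simp

/-- `H0m` is symmetric. -/
theorem H0m_isHermitian : Matrix.IsHermitian H0m := by
  ext i j; fin_cases i <;> fin_cases j <;> simp

/-- `H0m` is positive definite. -/
theorem H0m_posDef : Matrix.PosDef H0m := by
  rw [Matrix.posDef_iff_dotProduct_mulVec]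
  refine ⟨H0m_isHermitian, fun x hx => ?_⟩
  have hne : x 0 ≠ 0 ∨ x 1 ≠ 0 := by
    by_contra h
    push Not at h
    apply hx; funext i; fin_cases i <;> simp [h.1, h.2]
  have hq : star x ⬝ᵥ H0m *ᵥ x = x 0 ^ 2 + x 1 ^ 2 - x 0 * x 1 / 2 := by
    simp [Matrix.mulVec, dotProduct, Fin.sum_univ_two]; ring
  rw [hq]
  rcases hne with h | h
  · nlinarith [sq_pos_of_ne_zero h, sq_nonneg (x 1), sq_nonneg (x 0 - x 1)]
  · nlinarith [sq_pos_of_ne_zero h, sq_nonneg (x 0), sq_nonneg (x 0 - x 1)]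

/-- `Hfm` is symmetric. -/
theorem Hfm_isSymm : Matrix.IsSymm Hfm := by
  ext i j; fin_cases i <;> fin_cases j <;> simp

/-- the `δ = 1/2` Hessian sandwich of the model potential against `H0m`. -/
theorem sandwich (x h : Fin 2 → ℝ) :
    (1 - 1 / 2 : ℝ) * (h ⬝ᵥ H0m *ᵥ h) ≤ Afun (x + h) + Afun (x - h) - 2 * Afun x ∧
      Afun (x + h) + Afun (x - h) - 2 * Afun x ≤ (1 + 1 / 2 : ℝ) * (h ⬝ᵥ H0m *ᵥ h) := by
  have hq : h ⬝ᵥ H0m *ᵥ h = h 0 ^ 2 + h 1 ^ 2 - h 0 * h 1 / 2 := by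
    simp [Matrix.mulVec, dotProduct, Fin.sum_univ_two]; ring
  have hA : Afun (x + h) + Afun (x - h) - 2 * Afun x = h 0 ^ 2 + h 1 ^ 2 := by
    simp; ring
  rw [hq, hA]
  constructor <;> nlinarith [sq_nonneg (h 0 + h 1), sq_nonneg (h 0 - h 1), sq_nonneg (h 0), sq_nonneg (h 1)]

/-- the Gaussian covariance proxy `rC = 256/225 = 8ε`. -/
theorem rC_val : 2 * (H0m⁻¹ * Hfm * H0m⁻¹ * (1 : Matrix (Fin 2) (Fin 2) ℝ)).trace = 256 / 225 := by
  rw [H0m_inv]; simp [Matrix.trace, Fin.sum_univ_two]; norm_num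

/-- the Gaussian variance proxy `rVf = 272/225 ≤ Kε`. -/
theorem rVf_val : 2 * (H0m⁻¹ * Hfm * H0m⁻¹ * Hfm).trace = 272 / 225 := by
  rw [H0m_inv]; simp [Matrix.trace, Fin.sum_univ_two]; norm_num

/-- the Gaussian variance proxy `rVg = 1088/225 ≤ Kε`. -/
theorem rVg_val : 2 * (H0m⁻¹ * (1 : Matrix (Fin 2) (Fin 2) ℝ) * H0m⁻¹ * (1 : Matrix (Fin 2) (Fin 2) ℝ)).trace
    = 1088 / 225 := by
  rw [H0m_inv]; simp [Matrix.trace, Fin.sum_univ_two]; norm_num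

/-- conditional expectation of the zero function, in `fun` form (simp helper). -/
theorem condExp_fun_zero {Ω : Type*} {m m₀ : MeasurableSpace Ω} (μ : Measure Ω) :
    μ[fun _ : Ω => (0 : ℝ)|m] = 0 := condExp_zero

/-- **`SkewAtChartUnit` ⟺ NT clause (ii) at EVERY unit**: the chart-package hypothesis is vacuous. -/
theorem skewAtChartUnit_iff_forall_units :
    Summit.QuantumFields.YangMills.Theses.LogConcaveChart.SkewAtChartUnit ↔
    ∀ (G : Type) [Group G] [TopologicalSpace G] [IsTopologicalGroup G] [CompactSpace G],
      IsCompactSimpleLieGroup G → letI : MeasurableSpace G := borel G; haveI : BorelSpace G := ⟨rfl⟩;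
      ∀ (r : LatticeRep G) (a : ℝ → ℝ), (∀ β, 0 < a β) → Filter.Tendsto a Filter.atTop (nhds 0) →
        ∃ (f g h : 𝓢(EuclideanSpace ℝ (Fin 4), ℝ)) (ε β₅ Λ₅ : ℝ),
          Disjoint (tsupport (f : EuclideanSpace ℝ (Fin 4) → ℝ)) (tsupport (g : EuclideanSpace ℝ (Fin 4) → ℝ)) ∧
          Disjoint (tsupport (g : EuclideanSpace ℝ (Fin 4) → ℝ)) (tsupport (h : EuclideanSpace ℝ (Fin 4) → ℝ)) ∧
          Disjoint (tsupport (f : EuclideanSpace ℝ (Fin 4) → ℝ)) (tsupport (h : EuclideanSpace ℝ (Fin 4) → ℝ)) ∧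
          0 < ε ∧ ∀ β : ℝ, β₅ ≤ β → ∀ L : ℕ, Λ₅ ≤ a β * L → ε ≤ |Q3 G r β L (a β) f g h| := by
  constructor
  · intro hS G _ _ _ _ hG r a ha hlim
    refine hS G hG r a ha hlim ⟨40, 1 / 2, 0, 32 / 225, 0, 0, by norm_num, by norm_num, by norm_num, ?_,
      by norm_num, ?_⟩
    · rw [FunLike.coe_zero, tsupport_eq_empty_iff.mpr rfl]; exact Set.empty_subset _
    · intro β _ L _
      refine ⟨2, fun _ => 0, H0m, Hfm, 1, 0, 0, Afun, 0, 0, ?_⟩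
      dsimp only
      simp only [map_zero, zero_apply, zero_mul, mul_zero, Finset.sum_const_zero,
        zero_dotProduct, dotProduct_zero, Matrix.mulVec_zero, add_zero, integral_zero, sub_zero,
        condExp_fun_zero, Pi.zero_apply, Matrix.one_mulVec, int_fg, int_f, zero_div,
        abs_zero, norm_zero]
      refine ⟨measurable_const, fun _ => le_rfl, measurable_const, measurable_const, fun _ => le_rfl,
        fun _ => le_rfl, H0m_posDef, Hfm_isSymm, Matrix.isSymm_one, continuous_Afun, sandwich, centred,
        ?_, by norm_num, ?_, ?_, ?_, ?_, by norm_num, ?_, ?_, ?_, ?_, ?_⟩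
      · simp [Q2]
      · norm_num
      · norm_num
      · norm_num
      · norm_num
      · rw [rC_val]; norm_num
      · rw [rVf_val]; norm_num
      · rw [rVf_val]; norm_num
      · rw [rVg_val]; norm_num
      · rw [rVg_val]; norm_num
  · intro h G _ _ _ _ hG r a ha hlim _
    exact h G hG r a ha hlim


end Summit.QuantumFields.YangMills.Theorems.LogConcaveChartSkewAtChartUnit.Negative

end
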